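import Summits.CriticalPhenomena.PercolationContinuityZ3.Theorems.PercNearOneGluingNoHeavyLowerTailFrontierDecRowsPinnedEdgeInduction
import HarnessLib

/-!
# The seven open four-point decreasing frontier rows, each for ALL `n` from ONE family of five-point edge forms (pinned-terminal schema)

Support file (prover seat `prim-l12-p6`, gen 4; `--supports stmt-CriticalPhenomena-4575`).  No definitions, no named facts, no sorries, no `native_decide`.
Sequel of `…FrontierDecRowsPinnedEdgeInduction` (`TerminalEdgeInduction.sahiE3_sep_nonneg_of_unmarkedEdgeHypAt`: a triple of group separations one of
whose six sides is the single terminal `i₀` holds at every injective marking of every finite weighted graph as soon as the unmarked-edge hypotheses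
`UnmarkedEdgeHypAt i₀` — `B₁, B₂ ≥ 0` at the edges from THAT terminal to an unmarked vertex, given the induction hypotheses — hold for every number
of vertices).  Instances for the open rows of `…FrontierDecRowsLeFive` (terminal order `(a,b,c,y) = (x 0, x 1, x 2, x 3)`):
* `frontier_36_all_of_at (i₀ : Fin 4)` — PATH `(D[a|b], D[a|c], D[b|y])`, ALL markings, from the forms at ANY ONE terminal (bnk-1's
  `frontier_36_all_of_at0_at2` needed hub + leaf);
* `frontier_44_all_of_at (i₀ : Fin 4)` — row 44, all markings, any one terminal (bnk-1: `frontier_44_all_of_at0` via the symmetry group);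
* `frontier_12_of_at` (`i₀ ∈ {b,c,y}`), `frontier_15_of_at` (`{b,c,y}`), `frontier_27_of_at` (`{c,y}`), `frontier_30_of_at` (`{b,c}`),
  `frontier_37_of_at` (`{b,c,y}`) — pairwise distinct terminals (degenerate markings are three-point rows with their own theorems).
Which type to certify is now a free choice per row; the exhaustive census of the pieces per edge type (ttrl cp-hms,
run/shared/lean/ttrl/hms/BERNSTEIN-PIECES.md, Table A) ranks them: e.g. row 30 at `b` or `c` and row 37 at `b` have `min B₁/(B₀+B₃) ≈ 0.28 / 0.18`
with no exact zeros, while the pinned types of rows 27 (`c`,`y`), 44 and the PATH leaves carry the endpoint-zero locus (`B₁ = 0 < B₃`, `B₀ = 0`).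
-/

noncomputable section

namespace Summit.CriticalPhenomena.PercolationContinuityZ3.Theorems

namespace TerminalEdgeInduction

open MeasureTheory Literature.Probability.Percolation Literature.Probability.LatticeModels
open EdgeInduction CovTransferCert E3GroupSepCert
open scoped Classical

variable {n : ℕ}

/-! ### The seven open four-point rows: ONE terminal type each -/

/-- **PATH (row 36) on every finite weighted graph from the five-point forms at ANY ONE terminal.**  For each `i₀ : Fin 4` (hub `a`, hub `b`,
leaf `c` or leaf `y` of the path `c – a – b – y`): if the unmarked-edge hypotheses hold at the terminal `i₀` for every number of vertices, then
`0 ≤ E₃(D[a|b], D[a|c], D[b|y])` for all `n`, `w` and ALL `a b c y` (degenerate markings as in bnk-1's `frontier_36_all_of_unmarkedEdgeHyp`: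
empty separation / Harris / 3PT-LB at `c = y`).  bnk-1's `frontier_36_all_of_at0_at2` needed the hub AND the leaf forms. [this work] -/
theorem frontier_36_all_of_at (i₀ : Fin 4)
    (h : ∀ m : ℕ, UnmarkedEdgeHypAt i₀ (fun x : Fin 4 → Fin m => connEvent (FrontierDecRows.row 36 m (x 0, x 1, x 2, x 3)).1)
      (fun x => connEvent (FrontierDecRows.row 36 m (x 0, x 1, x 2, x 3)).2.1)
      (fun x => connEvent (FrontierDecRows.row 36 m (x 0, x 1, x 2, x 3)).2.2))
    (w : Sym2 (Fin n) → unitInterval) (a b c y : Fin n) :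
    0 ≤ sahiE3 (prodBernoulli w) (connEvent (FrontierDecRows.row 36 n (a, b, c, y)).1)
      (connEvent (FrontierDecRows.row 36 n (a, b, c, y)).2.1) (connEvent (FrontierDecRows.row 36 n (a, b, c, y)).2.2) := by
  have hpin : [0] = [i₀] ∨ [1] = [i₀] ∨ [0] = [i₀] ∨ [2] = [i₀] ∨ [1] = [i₀] ∨ [3] = [i₀] := by
    fin_cases i₀ <;> decide
  have hr : FrontierDecRows.row 36 n (a, b, c, y) = (sep [a] [b], sep [a] [c], sep [b] [y]) := rfl
  rw [hr]
  dsimp only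
  by_cases hab : a = b
  · subst hab; exact le_of_eq (sahiE3_sep_eq_zero_left (v := a) (by simp) (by simp) _ _).symm
  by_cases hac : a = c
  · subst hac; exact le_of_eq (sahiE3_sep_eq_zero_mid (v := a) (by simp) (by simp) _ _).symm
  by_cases hby : b = y
  · subst hby; exact le_of_eq (sahiE3_sep_eq_zero_right (v := b) (by simp) (by simp) _ _).symm
  by_cases hay : a = y
  · subst hay
    rw [connEvent_sep_comm [b] [a]]
    exact sahiE3_nonneg_of_repeat₁₃ w (isLowerSet_connEvent_sep _ _) (isLowerSet_connEvent_sep _ _)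
  by_cases hbc : b = c
  · subst hbc
    exact sahiE3_nonneg_of_repeat₁₂ w (isLowerSet_connEvent_sep _ _) (isLowerSet_connEvent_sep _ _)
  by_cases hcy : c = y
  · subst hcy
    rw [connEvent_sep_one_one, connEvent_sep_one_one, connEvent_sep_one_one]
    exact ThreePointLB.sahiE3_pairSep_nonneg w a b c
  exact sahiE3_sep_nonneg_of_unmarkedEdgeHypAt i₀ [0] [1] [0] [2] [1] [3] hpin h w ![a, b, c, y]
    (injective_vec4 hab hac hay hbc hby hcy)

/-- **Row 44 `(D[ab|cy], D[a|b], D[c|y])` on every finite weighted graph from the five-point forms at any one terminal** (all markings;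
for `i₀ = 0` this is bnk-1's `frontier_44_all_of_at0`, here without the symmetry transport). [this work] -/
theorem frontier_44_all_of_at (i₀ : Fin 4)
    (h : ∀ m : ℕ, UnmarkedEdgeHypAt i₀ (fun x : Fin 4 → Fin m => connEvent (FrontierDecRows.row 44 m (x 0, x 1, x 2, x 3)).1)
      (fun x => connEvent (FrontierDecRows.row 44 m (x 0, x 1, x 2, x 3)).2.1)
      (fun x => connEvent (FrontierDecRows.row 44 m (x 0, x 1, x 2, x 3)).2.2))
    (w : Sym2 (Fin n) → unitInterval) (a b c y : Fin n) :
    0 ≤ sahiE3 (prodBernoulli w) (connEvent (FrontierDecRows.row 44 n (a, b, c, y)).1)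
      (connEvent (FrontierDecRows.row 44 n (a, b, c, y)).2.1) (connEvent (FrontierDecRows.row 44 n (a, b, c, y)).2.2) := by
  have hpin : [0, 1] = [i₀] ∨ [2, 3] = [i₀] ∨ [0] = [i₀] ∨ [1] = [i₀] ∨ [2] = [i₀] ∨ [3] = [i₀] := by
    fin_cases i₀ <;> decide
  have hr : FrontierDecRows.row 44 n (a, b, c, y) = (sep [a, b] [c, y], sep [a] [b], sep [c] [y]) := rfl
  rw [hr]
  dsimp only
  by_cases hab : a = b
  · subst hab; exact le_of_eq (sahiE3_sep_eq_zero_mid (v := a) (by simp) (by simp) _ _).symm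
  by_cases hcy : c = y
  · subst hcy; exact le_of_eq (sahiE3_sep_eq_zero_right (v := c) (by simp) (by simp) _ _).symm
  by_cases hac : a = c
  · subst hac; exact le_of_eq (sahiE3_sep_eq_zero_left (v := a) (by simp) (by simp) _ _).symm
  by_cases hay : a = y
  · subst hay; exact le_of_eq (sahiE3_sep_eq_zero_left (v := a) (by simp) (by simp) _ _).symm
  by_cases hbc : b = c
  · subst hbc; exact le_of_eq (sahiE3_sep_eq_zero_left (v := b) (by simp) (by simp) _ _).symm
  by_cases hby : b = y
  · subst hby; exact le_of_eq (sahiE3_sep_eq_zero_left (v := b) (by simp) (by simp) _ _).symm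
  exact sahiE3_sep_nonneg_of_unmarkedEdgeHypAt i₀ [0, 1] [2, 3] [0] [1] [2] [3] hpin h w ![a, b, c, y]
    (injective_vec4 hab hac hay hbc hby hcy)

/-- **Row 12 `(D[ab|c], D[ac|by], D[b|y])` at pairwise distinct terminals, for all `n`, from the forms at ONE of `b`, `c`, `y`.** [this work] -/
theorem frontier_12_of_at (i₀ : Fin 4) (hi₀ : i₀ = 1 ∨ i₀ = 2 ∨ i₀ = 3)
    (h : ∀ m : ℕ, UnmarkedEdgeHypAt i₀ (fun x : Fin 4 → Fin m => connEvent (FrontierDecRows.row 12 m (x 0, x 1, x 2, x 3)).1)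
      (fun x => connEvent (FrontierDecRows.row 12 m (x 0, x 1, x 2, x 3)).2.1)
      (fun x => connEvent (FrontierDecRows.row 12 m (x 0, x 1, x 2, x 3)).2.2))
    (w : Sym2 (Fin n) → unitInterval) (a b c y : Fin n) (hab : a ≠ b) (hac : a ≠ c) (hay : a ≠ y) (hbc : b ≠ c)
    (hby : b ≠ y) (hcy : c ≠ y) :
    0 ≤ sahiE3 (prodBernoulli w) (connEvent (FrontierDecRows.row 12 n (a, b, c, y)).1)
      (connEvent (FrontierDecRows.row 12 n (a, b, c, y)).2.1) (connEvent (FrontierDecRows.row 12 n (a, b, c, y)).2.2) := by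
  have hx := injective_vec4 hab hac hay hbc hby hcy
  have hpin : [0, 1] = [i₀] ∨ [2] = [i₀] ∨ [0, 2] = [i₀] ∨ [1, 3] = [i₀] ∨ [1] = [i₀] ∨ [3] = [i₀] := by
    rcases hi₀ with rfl | rfl | rfl <;> decide
  exact sahiE3_sep_nonneg_of_unmarkedEdgeHypAt i₀ [0, 1] [2] [0, 2] [1, 3] [1] [3] hpin h w ![a, b, c, y] hx

/-- **Row 15 `(D[ab|c], D[ac|y], D[b|y])` at pairwise distinct terminals, for all `n`, from the forms at ONE of `b`, `c`, `y`.** [this work] -/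
theorem frontier_15_of_at (i₀ : Fin 4) (hi₀ : i₀ = 1 ∨ i₀ = 2 ∨ i₀ = 3)
    (h : ∀ m : ℕ, UnmarkedEdgeHypAt i₀ (fun x : Fin 4 → Fin m => connEvent (FrontierDecRows.row 15 m (x 0, x 1, x 2, x 3)).1)
      (fun x => connEvent (FrontierDecRows.row 15 m (x 0, x 1, x 2, x 3)).2.1)
      (fun x => connEvent (FrontierDecRows.row 15 m (x 0, x 1, x 2, x 3)).2.2))
    (w : Sym2 (Fin n) → unitInterval) (a b c y : Fin n) (hab : a ≠ b) (hac : a ≠ c) (hay : a ≠ y) (hbc : b ≠ c)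
    (hby : b ≠ y) (hcy : c ≠ y) :
    0 ≤ sahiE3 (prodBernoulli w) (connEvent (FrontierDecRows.row 15 n (a, b, c, y)).1)
      (connEvent (FrontierDecRows.row 15 n (a, b, c, y)).2.1) (connEvent (FrontierDecRows.row 15 n (a, b, c, y)).2.2) := by
  have hx := injective_vec4 hab hac hay hbc hby hcy
  have hpin : [0, 1] = [i₀] ∨ [2] = [i₀] ∨ [0, 2] = [i₀] ∨ [3] = [i₀] ∨ [1] = [i₀] ∨ [3] = [i₀] := by
    rcases hi₀ with rfl | rfl | rfl <;> decide
  exact sahiE3_sep_nonneg_of_unmarkedEdgeHypAt i₀ [0, 1] [2] [0, 2] [3] [1] [3] hpin h w ![a, b, c, y] hx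

/-- **Row 27 `(D[ab|c], D[ab|y], D[ac|by])` at pairwise distinct terminals, for all `n`, from the forms at ONE of `c`, `y`.** [this work] -/
theorem frontier_27_of_at (i₀ : Fin 4) (hi₀ : i₀ = 2 ∨ i₀ = 3)
    (h : ∀ m : ℕ, UnmarkedEdgeHypAt i₀ (fun x : Fin 4 → Fin m => connEvent (FrontierDecRows.row 27 m (x 0, x 1, x 2, x 3)).1)
      (fun x => connEvent (FrontierDecRows.row 27 m (x 0, x 1, x 2, x 3)).2.1)
      (fun x => connEvent (FrontierDecRows.row 27 m (x 0, x 1, x 2, x 3)).2.2))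
    (w : Sym2 (Fin n) → unitInterval) (a b c y : Fin n) (hab : a ≠ b) (hac : a ≠ c) (hay : a ≠ y) (hbc : b ≠ c)
    (hby : b ≠ y) (hcy : c ≠ y) :
    0 ≤ sahiE3 (prodBernoulli w) (connEvent (FrontierDecRows.row 27 n (a, b, c, y)).1)
      (connEvent (FrontierDecRows.row 27 n (a, b, c, y)).2.1) (connEvent (FrontierDecRows.row 27 n (a, b, c, y)).2.2) := by
  have hx := injective_vec4 hab hac hay hbc hby hcy
  have hpin : [0, 1] = [i₀] ∨ [2] = [i₀] ∨ [0, 1] = [i₀] ∨ [3] = [i₀] ∨ [0, 2] = [i₀] ∨ [1, 3] = [i₀] := by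
    rcases hi₀ with rfl | rfl <;> decide
  exact sahiE3_sep_nonneg_of_unmarkedEdgeHypAt i₀ [0, 1] [2] [0, 1] [3] [0, 2] [1, 3] hpin h w ![a, b, c, y] hx

/-- **Row 30 `(D[ab|c], D[ac|by], D[b|cy])` at pairwise distinct terminals, for all `n`, from the forms at ONE of `b`, `c`** — by the
census the roomiest open case (`min B₁/(B₀+B₃) ≈ 0.28` at both types, no exact zeros). [this work] -/
theorem frontier_30_of_at (i₀ : Fin 4) (hi₀ : i₀ = 1 ∨ i₀ = 2)
    (h : ∀ m : ℕ, UnmarkedEdgeHypAt i₀ (fun x : Fin 4 → Fin m => connEvent (FrontierDecRows.row 30 m (x 0, x 1, x 2, x 3)).1)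
      (fun x => connEvent (FrontierDecRows.row 30 m (x 0, x 1, x 2, x 3)).2.1)
      (fun x => connEvent (FrontierDecRows.row 30 m (x 0, x 1, x 2, x 3)).2.2))
    (w : Sym2 (Fin n) → unitInterval) (a b c y : Fin n) (hab : a ≠ b) (hac : a ≠ c) (hay : a ≠ y) (hbc : b ≠ c)
    (hby : b ≠ y) (hcy : c ≠ y) :
    0 ≤ sahiE3 (prodBernoulli w) (connEvent (FrontierDecRows.row 30 n (a, b, c, y)).1)
      (connEvent (FrontierDecRows.row 30 n (a, b, c, y)).2.1) (connEvent (FrontierDecRows.row 30 n (a, b, c, y)).2.2) := by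
  have hx := injective_vec4 hab hac hay hbc hby hcy
  have hpin : [0, 1] = [i₀] ∨ [2] = [i₀] ∨ [0, 2] = [i₀] ∨ [1, 3] = [i₀] ∨ [1] = [i₀] ∨ [2, 3] = [i₀] := by
    rcases hi₀ with rfl | rfl <;> decide
  exact sahiE3_sep_nonneg_of_unmarkedEdgeHypAt i₀ [0, 1] [2] [0, 2] [1, 3] [1] [2, 3] hpin h w ![a, b, c, y] hx

/-- **Row 37 `(D[ab|c], D[ac|y], D[ay|b])` at pairwise distinct terminals, for all `n`, from the forms at ONE of `b`, `c`, `y`** (hub `a`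
edges are exact by prim-l12-p1's hub stripping; here the non-hub types). [this work] -/
theorem frontier_37_of_at (i₀ : Fin 4) (hi₀ : i₀ = 1 ∨ i₀ = 2 ∨ i₀ = 3)
    (h : ∀ m : ℕ, UnmarkedEdgeHypAt i₀ (fun x : Fin 4 → Fin m => connEvent (FrontierDecRows.row 37 m (x 0, x 1, x 2, x 3)).1)
      (fun x => connEvent (FrontierDecRows.row 37 m (x 0, x 1, x 2, x 3)).2.1)
      (fun x => connEvent (FrontierDecRows.row 37 m (x 0, x 1, x 2, x 3)).2.2))
    (w : Sym2 (Fin n) → unitInterval) (a b c y : Fin n) (hab : a ≠ b) (hac : a ≠ c) (hay : a ≠ y) (hbc : b ≠ c)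
    (hby : b ≠ y) (hcy : c ≠ y) :
    0 ≤ sahiE3 (prodBernoulli w) (connEvent (FrontierDecRows.row 37 n (a, b, c, y)).1)
      (connEvent (FrontierDecRows.row 37 n (a, b, c, y)).2.1) (connEvent (FrontierDecRows.row 37 n (a, b, c, y)).2.2) := by
  have hx := injective_vec4 hab hac hay hbc hby hcy
  have hpin : [0, 1] = [i₀] ∨ [2] = [i₀] ∨ [0, 2] = [i₀] ∨ [3] = [i₀] ∨ [0, 3] = [i₀] ∨ [1] = [i₀] := by
    rcases hi₀ with rfl | rfl | rfl <;> decide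
  exact sahiE3_sep_nonneg_of_unmarkedEdgeHypAt i₀ [0, 1] [2] [0, 2] [3] [0, 3] [1] hpin h w ![a, b, c, y] hx

end TerminalEdgeInduction

end Summit.CriticalPhenomena.PercolationContinuityZ3.Theorems
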